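/-
Copyright: cell `pub-ymgap` (HUMAN RULING D-0062), Track A of `YM-PLAN.md`, DAG node N20 (= NE7b); R134 acceleration seat
`pub-ymgap-dag-n20-d` (generation 3).  Released under the licence of the surrounding project.
-/
import Summits.QuantumFields.YangMills.Theorems.UnitScaleTiltHistoryTailFirstOrderLoops
import Summits.QuantumFields.YangMills.Theorems.UnitScaleTiltHistoryTailStokesLocal
import Summits.QuantumFields.YangMills.Theorems.UnitScaleTiltHistoryTailWalkLocality
import Literature.MathematicalPhysics.QuantumFieldTheory.Balaban1983to89.B8Eq110UnitaryProof
import HarnessLib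

/-!
# YM-DAG node N20 (= NE7b): THE DOMINATION LETTER FOR BAŁABAN'S (0.4) BLOCK AVERAGING OF RECORD — on fields whose plaquettes NEAR a
# coarse plaquette `p′` are small, `1 − Re tr Ū(∂p′) ≤ C₁ · Σ_{q near p′} (1 − Re tr U(∂q))` for `Ū = avgFun expMeanLogSU U` on `SU(N)`
# (local crude form of [Balaban1985Averaging] Prop. 1 for the (0.4) averaging, in the Wilson-energy currency)

Track A of `YM-PLAN.md` (cell `pub-ymgap`, HUMAN RULING D-0062), node **N20** = spine estimate NE7b (`T4WeightBudget.RelWeightBound` — the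
cell `pub-balaban`'s OWN estimate, NOT PRINTED in [Bałaban 1983–89], NOT PROVED).  Seat `pub-ymgap-dag-n20-d` (R134), generation 3; kernel
theorems only: 0 `def`, 0 `sorry`, standard axioms; COUNT-NEUTRAL.

WHY.  The s1 column of N20 («the `LocCondStability` INSTANCE») transfers the level-0 local exponential plaquette moments (LS)₀ to the
averaged level through a DOMINATION LETTER (seat `pub-ymgap-dag-n20-c`, module 1 `…Theorems.BalabanUVNodesN20LCSPushforward`,
`localExpMoment_blockMap`, hypothesis `hdom`): *for every coarse plaquette `P` there is a finite set `R P` of fine plaquettes such that,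
whenever every `q ∈ R P` has energy `≤ α`, the energy of the block-mapped field at `P` is at most `C₁ · Σ_{q ∈ R P} energy(q)`*.  Module 2 of
that seat discharged the letter for Wilson loops ∕ decimation; for Bałaban's AVERAGING OF RECORD (`Node00.avOfRecord = BlockAveraging.blockAvg
expMeanLogSU`, the (0.4) operation of [Balaban1987RG1] with the printed `exp[mean log]` on `SU(N)`) it was the located residual (i) of the
node's triage (`N20-S1-TRIAGE.md` §1: «NAS + averaging spread of exp[mean log]»).  THIS FILE PROVES IT, by assembling tree theorems:

* the LOCAL non-abelian Stokes chain of route `UnitScaleTilt`'s crux K2 (`HistoryTailStokesLocal.dist1_loopHol_le_loc`: the (0.4) loop variables at a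
  coarse bond `c` are `(((d+2)L)²/4)·δ`-close to `1` as soon as the plaquettes cornered at the sites `walkEnd (emb c₋) v`, `|v| ≤ (d+2)L + 2`, are
  `δ`-close to `1`; `HistoryTailFirstOrderLoops.dist1_corr_le_of_loops`: then the correction factor `corr(c)` of (0.4) is `6t`-close to `1`,
  `t < δ_N`), the square Stokes bound for the straight transporters (`B10Eq47AxialChi.dist1_plaqHol_axialAvg_le`), the insertion inequality
  `BlockAveragingPlaquetteBound.dist1_plaquette_with_corr_le` — giving the LOCAL twin of the tree's global crude Prop. 1
  `BlockAveragingPlaquetteBound.dist1_plaqHol_avgFun_lt`: **`dist1_plaqHol_avgFun_le_loc`**, `|Ū(∂p′) − 1| ≤ (L² + 6((d+2)L)²)·δ` when the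
  plaquettes cornered at `walkEnd (emb p′₋) v`, `|v| ≤ (d+3)L + 2`, are `δ`-close to `1` (`0 ≤ δ`, `(((d+2)L)²/4)·δ < δ_N`), with the sum form
  **`dist1_plaqHol_avgFun_le_sum_add_loc`** (`≤ Σ_{t,s<L} |U(∂q_{t,s}) − 1| + 6((d+2)L)²·δ`);
* the two comparisons between the operator-norm size `|g − 1|` and the Wilson energy `1 − Re tr g ∕ N` on `SU(N)`
  (`B8Eq110UnitaryProof.cmp_specialUnitaryGroup`: `1 − reTr g ≤ |g − 1|²`; `cmp'_specialUnitaryGroup`: `|g − 1|² ≤ 2N(1 − reTr g)`) and the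
  elementary «max ≤ sum» for nonnegative energies — giving THE LETTER **`one_sub_reTr_plaqHol_avgFun_le_mul_sum`**: for every finite set `R`
  of fine plaquettes containing those cornered at `walkEnd (emb p′₋) v`, `|v| ≤ (d+3)L + 2`, and every `α` with
  `(((d+2)L)²/4)·√(2Nα) < δ_N`: if `1 − reTr U(∂q) ≤ α` for all `q ∈ R`, then
  `1 − reTr Ū(∂p′) ≤ 2N·(L² + 6((d+2)L)²)²·Σ_{q∈R} (1 − reTr U(∂q))`; and its BOX form **`one_sub_reTr_plaqHol_avgFun_le_mul_sum_of_box`**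
  (`R` ⊇ the plaquettes cornered in the `ℓ∞`-ball of radius `(d+3)L + 2` around `emb p′₋`, via `HistoryTailWalkLocality.walkEnd_mem_box`) — the
  shape of `hdom` with `Φ = avgFun expMeanLogSU`, `C₁ = 2N·(L² + 6((d+2)L)²)²`, threshold `α`.

HONEST FRAMING.  Deterministic lattice gauge algebra on ONE configuration of `T^{(j)}` (standing range `j + 1 ≤ m + K`); no measure, no
effective action; the constants are crude (the printed leading coefficient `L²` of (51) is not reproduced).  What it moves: residual (i) of the
N20∕s1 triage becomes a tree theorem in the `Setup` currency (`GaugeField P j SU(N)`, `reTr`, `avgFun`); the carrier junction to the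
`GaugeConfig` currency of module 1 (n20-c residual (iii), closed at level 0 by its modules 6–7) and the region-count bookkeeping (`m`, `n` of
`localExpMoment_blockMap`) are the consumer's, not done here.  NE7b NOT PRINTED ∕ NOT PROVED; (α)-instance 0∕1; N20 NOT discharged; typed
28∕28, discharged count untouched; one finite four-torus at fixed `ε` — NOT ℝ⁴, NOT infinite volume, NOT OS, NOT a mass gap, NOT Clay.

References: T. Bałaban, CMP 98 (1985) 17–51 [Balaban1985Averaging] (Prop. 1 (51) p.26, (19)–(20) p.21, (26)–(27) p.22); CMP 109 (1987)
249–301 [Balaban1987RG1] ((0.4) p.253); CMP 99 (1985) 75–102 [Balaban1985RegularSpaces] ((1.10) p.77).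
-/

noncomputable section

open scoped BigOperators Matrix.Norms.L2Operator

namespace Summit.QuantumFields.YangMills.BalabanUVNodes.N20LCSAvgDomination

open Literature.MathematicalPhysics.QuantumFieldTheory.Balaban1983to89
open T4Continuum T4ReflectionCone BlockAveraging AveragingRT B10Eq47AxialChi ExpMeanLog BlockAveragingPlaquetteBound
open Summit.QuantumFields.YangMills.Theorems.HistoryTailStokesLocal (dist1_loopHol_le_loc)
open Summit.QuantumFields.YangMills.Theorems.HistoryTailFirstOrderLoops (dist1_corr_le_of_loops)
open Summit.QuantumFields.YangMills.Theorems.HistoryTailWalkLocality (walkEnd_mem_box)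

variable {P : Params} {j : ℕ}

/-! ## §1 Walk geometry: iterated shifts are walk ends; walk-local smallness moves to the neighbouring block centres -/

section Walks

variable {G : Type*} [GaugeGroup G]

/-- `x + n e_μ` is the end of the walk `(+e_μ)^n` from `x`. [folklore] -/
theorem shiftN_eq_walkEnd_replicate (x : Site P j) (μ : Fin P.d) :
    ∀ n : ℕ, shiftN x μ n = walkEnd x (List.replicate n (μ, true))
  | 0 => rfl
  | n + 1 => by
    rw [shiftN_succ, shiftN_eq_walkEnd_replicate x μ n, List.replicate_succ', walkEnd_append]
    rfl

/-- `x + t e_ν + s e_μ` is the end of the walk `(+e_ν)^t (+e_μ)^s` from `x`, a word of length `t + s`. [folklore] -/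
theorem shiftN_shiftN_eq_walkEnd (x : Site P j) (μ ν : Fin P.d) (t s : ℕ) :
    shiftN (shiftN x ν t) μ s = walkEnd x (List.replicate t (ν, true) ++ List.replicate s (μ, true)) := by
  rw [walkEnd_append, ← shiftN_eq_walkEnd_replicate, ← shiftN_eq_walkEnd_replicate]

/-- WALK-LOCAL SMALLNESS IS MONOTONE IN THE RADIUS. [folklore] -/
theorem walkLocal_mono (U : GaugeField P j G) (x : Site P j) {R R' : ℕ} (hRR' : R ≤ R') {δ : ℝ}
    (hU : ∀ v : List (Letter P.d), v.length ≤ R' →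
      ∀ (a b : Fin P.d) (h : a < b), dist1 (GaugeField.plaqHol U ⟨walkEnd x v, a, b, h⟩) ≤ δ) :
    ∀ v : List (Letter P.d), v.length ≤ R →
      ∀ (a b : Fin P.d) (h : a < b), dist1 (GaugeField.plaqHol U ⟨walkEnd x v, a, b, h⟩) ≤ δ :=
  fun v hv a b h => hU v (hv.trans hRR') a b h

/-- **WALK-LOCAL SMALLNESS AT A BLOCK CENTRE WITH RADIUS `R + L` GIVES WALK-LOCAL SMALLNESS WITH RADIUS `R` AT THE NEIGHBOURING BLOCK
CENTRE** `emb (y + e_μ) = emb y + L e_μ` (standing range): prefix the walk by `(+e_μ)^L`. [cite: Balaban1987RG1, (0.1) p.252] -/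
theorem walkLocal_emb_shift (hj : j + 1 ≤ P.m + P.K) (U : GaugeField P j G) (y : Site P (j + 1)) (μ : Fin P.d) {R : ℕ} {δ : ℝ}
    (hU : ∀ v : List (Letter P.d), v.length ≤ R + P.L →
      ∀ (a b : Fin P.d) (h : a < b), dist1 (GaugeField.plaqHol U ⟨walkEnd (emb y) v, a, b, h⟩) ≤ δ) :
    ∀ v : List (Letter P.d), v.length ≤ R →
      ∀ (a b : Fin P.d) (h : a < b), dist1 (GaugeField.plaqHol U ⟨walkEnd (emb (y.shift μ)) v, a, b, h⟩) ≤ δ := by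
  intro v hv a b h
  have hsite : walkEnd (emb (y.shift μ)) v = walkEnd (emb y) (List.replicate P.L (μ, true) ++ v) := by
    rw [walkEnd_append, ← shiftN_eq_walkEnd_replicate, emb_shift hj]
  rw [hsite]
  refine hU _ ?_ a b h
  rw [List.length_append, List.length_replicate]
  omega

end Walks

/-! ## §2 The local crude Prop. 1 for the (0.4) averaging with `exp[mean log]` on `SU(N)`, in the size `|· − 1|` -/

section Dist

variable {n : Type*} [Fintype n] [DecidableEq n] [Nonempty n]

/-- **THE CORRECTION FACTOR OF (0.4) IS CLOSE TO `1` WHERE THE FIELD IS SMALL NEAR THE BLOCK** (local twin of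
`BlockAveragingPlaquetteBound.dist1_corr_le`): if the plaquettes cornered at `walkEnd (emb c₋) v`, `|v| ≤ (d+2)L + 2`, are `δ`-close to `1`
(`δ ≥ 0`) and `t := (((d+2)L)²/4)·δ < δ_N`, then `|corr(c) − 1| ≤ 6t`. [cite: Balaban1987RG1, (0.4) p.253] -/
theorem dist1_corr_le_loc {δ : ℝ} (hδ : 0 ≤ δ) {U : GaugeField P j (Matrix.specialUnitaryGroup n ℂ)} (c : PBond P (j + 1))
    (hU : ∀ v : List (Letter P.d), v.length ≤ (P.d + 2) * P.L + 2 →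
      ∀ (a b : Fin P.d) (h : a < b), dist1 (GaugeField.plaqHol U ⟨walkEnd (emb c.src) v, a, b, h⟩) ≤ δ)
    (ht : ((((P.d + 2) * P.L : ℕ) : ℝ) ^ 2 / 4) * δ < deltaSU n) :
    dist1 (corr (expMeanLogSU (n := n)) U c) ≤ 6 * (((((P.d + 2) * P.L : ℕ) : ℝ) ^ 2 / 4) * δ) :=
  dist1_corr_le_of_loops (fun i => dist1_loopHol_le_loc U hδ c hU i) ht

/-- **THE COARSE PLAQUETTE OF THE (0.4)-AVERAGED FIELD UNDER WALK-LOCAL SMALLNESS, SUM FORM** (standing range `j + 1 ≤ m + K`): if the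
plaquettes cornered at `walkEnd (emb p′₋) v`, `|v| ≤ (d+3)L + 2`, are `δ`-close to `1` (`δ ≥ 0`, `(((d+2)L)²/4)·δ < δ_N`), then
`|Ū(∂p′) − 1| ≤ Σ_{t<L} Σ_{s<L} |U(∂q_{s,t}) − 1| + 6((d+2)L)²·δ` — the `L × L` square of the straight transporters plus the four correction
factors (the walks to the three other block centres are prefixed by `(+e_μ)^L` ∕ `(+e_ν)^L`).
[cite: Balaban1985Averaging, Prop. 1 (51) p.26; Balaban1987RG1, (0.4) p.253] -/
theorem dist1_plaqHol_avgFun_le_sum_add_loc (hj : j + 1 ≤ P.m + P.K) {δ : ℝ} (hδ : 0 ≤ δ)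
    {U : GaugeField P j (Matrix.specialUnitaryGroup n ℂ)} (p : Plaq P (j + 1))
    (hU : ∀ v : List (Letter P.d), v.length ≤ (P.d + 3) * P.L + 2 →
      ∀ (a b : Fin P.d) (h : a < b), dist1 (GaugeField.plaqHol U ⟨walkEnd (emb p.src) v, a, b, h⟩) ≤ δ)
    (ht : ((((P.d + 2) * P.L : ℕ) : ℝ) ^ 2 / 4) * δ < deltaSU n) :
    dist1 (GaugeField.plaqHol (avgFun (expMeanLogSU (n := n)) U) p) ≤
      (∑ t ∈ Finset.range P.L, ∑ s ∈ Finset.range P.L,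
          dist1 (GaugeField.plaqHol U ⟨shiftN (shiftN (emb p.src) p.ν t) p.μ s, p.μ, p.ν, p.hμν⟩)) +
        6 * (((P.d + 2) * P.L : ℕ) : ℝ) ^ 2 * δ := by
  -- the walk-local hypothesis at the four block centres, radius `(d+2)L + 2`
  have hR : (P.d + 2) * P.L + 2 + P.L = (P.d + 3) * P.L + 2 := by ring
  have hU' : ∀ v : List (Letter P.d), v.length ≤ (P.d + 2) * P.L + 2 + P.L →
      ∀ (a b : Fin P.d) (h : a < b), dist1 (GaugeField.plaqHol U ⟨walkEnd (emb p.src) v, a, b, h⟩) ≤ δ := by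
    rw [hR]; exact hU
  have h₁ := walkLocal_mono U (emb p.src) (show (P.d + 2) * P.L + 2 ≤ (P.d + 3) * P.L + 2 by nlinarith) hU
  have h₂ := walkLocal_emb_shift hj U p.src p.μ hU'
  have h₃ := walkLocal_emb_shift hj U p.src p.ν hU'
  have hc₁ := dist1_corr_le_loc (n := n) hδ ⟨p.src, p.μ⟩ h₁ ht
  have hc₂ := dist1_corr_le_loc (n := n) hδ ⟨p.src.shift p.μ, p.ν⟩ h₂ ht
  have hc₃ := dist1_corr_le_loc (n := n) hδ ⟨p.src.shift p.ν, p.μ⟩ h₃ ht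
  have hc₄ := dist1_corr_le_loc (n := n) hδ ⟨p.src, p.ν⟩ h₁ ht
  have hax := dist1_plaqHol_axialAvg_le hj U p
  have hins := dist1_plaquette_with_corr_le
    (corr (expMeanLogSU (n := n)) U ⟨p.src, p.μ⟩) (axialAvg U ⟨p.src, p.μ⟩)
    (corr (expMeanLogSU (n := n)) U ⟨p.src.shift p.μ, p.ν⟩) (axialAvg U ⟨p.src.shift p.μ, p.ν⟩)
    (corr (expMeanLogSU (n := n)) U ⟨p.src.shift p.ν, p.μ⟩) (axialAvg U ⟨p.src.shift p.ν, p.μ⟩)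
    (corr (expMeanLogSU (n := n)) U ⟨p.src, p.ν⟩) (axialAvg U ⟨p.src, p.ν⟩)
  have hax' : dist1 (axialAvg U ⟨p.src, p.μ⟩ * axialAvg U ⟨p.src.shift p.μ, p.ν⟩ *
      (axialAvg U ⟨p.src.shift p.ν, p.μ⟩)⁻¹ * (axialAvg U ⟨p.src, p.ν⟩)⁻¹) ≤
      ∑ t ∈ Finset.range P.L, ∑ s ∈ Finset.range P.L,
        dist1 (GaugeField.plaqHol U ⟨shiftN (shiftN (emb p.src) p.ν t) p.μ s, p.μ, p.ν, p.hμν⟩) := hax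
  show dist1 (corr _ U ⟨p.src, p.μ⟩ * axialAvg U ⟨p.src, p.μ⟩ *
      (corr _ U ⟨p.src.shift p.μ, p.ν⟩ * axialAvg U ⟨p.src.shift p.μ, p.ν⟩) *
      (corr _ U ⟨p.src.shift p.ν, p.μ⟩ * axialAvg U ⟨p.src.shift p.ν, p.μ⟩)⁻¹ *
      (corr _ U ⟨p.src, p.ν⟩ * axialAvg U ⟨p.src, p.ν⟩)⁻¹) ≤ _
  have hκ : 6 * (((((P.d + 2) * P.L : ℕ) : ℝ) ^ 2 / 4) * δ) * 4 = 6 * (((P.d + 2) * P.L : ℕ) : ℝ) ^ 2 * δ := by ring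
  linarith

/-- **[Balaban1985Averaging] PROP. 1, CRUDE LOCAL FORM, FOR THE (0.4) AVERAGING WITH `exp[mean log]` ON `SU(N)`** (standing range): if the
plaquettes cornered at `walkEnd (emb p′₋) v`, `|v| ≤ (d+3)L + 2`, are `δ`-close to `1` (`δ ≥ 0`, `(((d+2)L)²/4)·δ < δ_N`), then
`|Ū(∂p′) − 1| ≤ (L² + 6((d+2)L)²)·δ` — the constant of the tree's global `BlockAveragingPlaquetteBound.dist1_plaqHol_avgFun_lt`, now from
smallness NEAR `p′` only. [cite: Balaban1985Averaging, Prop. 1 (51) p.26; Balaban1987RG1, (0.4) p.253] -/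
theorem dist1_plaqHol_avgFun_le_loc (hj : j + 1 ≤ P.m + P.K) {δ : ℝ} (hδ : 0 ≤ δ)
    {U : GaugeField P j (Matrix.specialUnitaryGroup n ℂ)} (p : Plaq P (j + 1))
    (hU : ∀ v : List (Letter P.d), v.length ≤ (P.d + 3) * P.L + 2 →
      ∀ (a b : Fin P.d) (h : a < b), dist1 (GaugeField.plaqHol U ⟨walkEnd (emb p.src) v, a, b, h⟩) ≤ δ)
    (ht : ((((P.d + 2) * P.L : ℕ) : ℝ) ^ 2 / 4) * δ < deltaSU n) :
    dist1 (GaugeField.plaqHol (avgFun (expMeanLogSU (n := n)) U) p) ≤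
      ((P.L : ℝ) ^ 2 + 6 * (((P.d + 2) * P.L : ℕ) : ℝ) ^ 2) * δ := by
  have hmain := dist1_plaqHol_avgFun_le_sum_add_loc (n := n) hj hδ p hU ht
  -- each plaquette of the `L × L` square is cornered at a walk end of length `t + s ≤ 2L ≤ (d+3)L + 2`
  have hsq : ∀ t ∈ Finset.range P.L, ∀ s ∈ Finset.range P.L,
      dist1 (GaugeField.plaqHol U ⟨shiftN (shiftN (emb p.src) p.ν t) p.μ s, p.μ, p.ν, p.hμν⟩) ≤ δ := by
    intro t ht' s hs'
    rw [Finset.mem_range] at ht' hs'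
    rw [shiftN_shiftN_eq_walkEnd]
    refine hU _ ?_ _ _ _
    rw [List.length_append, List.length_replicate, List.length_replicate]
    nlinarith
  have hsum : ∑ t ∈ Finset.range P.L, ∑ s ∈ Finset.range P.L,
      dist1 (GaugeField.plaqHol U ⟨shiftN (shiftN (emb p.src) p.ν t) p.μ s, p.μ, p.ν, p.hμν⟩) ≤ (P.L : ℝ) ^ 2 * δ := by
    calc ∑ t ∈ Finset.range P.L, ∑ s ∈ Finset.range P.L,
          dist1 (GaugeField.plaqHol U ⟨shiftN (shiftN (emb p.src) p.ν t) p.μ s, p.μ, p.ν, p.hμν⟩)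
        ≤ ∑ _t ∈ Finset.range P.L, ∑ _s ∈ Finset.range P.L, δ :=
          Finset.sum_le_sum fun t ht' => Finset.sum_le_sum fun s hs' => hsq t ht' s hs'
      _ = (P.L : ℝ) ^ 2 * δ := by simp [Finset.sum_const, Finset.card_range]; ring
  calc dist1 (GaugeField.plaqHol (avgFun (expMeanLogSU (n := n)) U) p)
      ≤ (∑ t ∈ Finset.range P.L, ∑ s ∈ Finset.range P.L,
          dist1 (GaugeField.plaqHol U ⟨shiftN (shiftN (emb p.src) p.ν t) p.μ s, p.μ, p.ν, p.hμν⟩)) +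
        6 * (((P.d + 2) * P.L : ℕ) : ℝ) ^ 2 * δ := hmain
    _ ≤ (P.L : ℝ) ^ 2 * δ + 6 * (((P.d + 2) * P.L : ℕ) : ℝ) ^ 2 * δ := add_le_add hsum le_rfl
    _ = ((P.L : ℝ) ^ 2 + 6 * (((P.d + 2) * P.L : ℕ) : ℝ) ^ 2) * δ := by ring

end Dist

/-! ## §3 The domination letter in the Wilson-energy currency `1 − Re tr ∕ N` -/

section Energy

open Literature.MathematicalPhysics.QuantumFieldTheory.Balaban1983to89.B8Eq110UnitaryProof
  (cmp_specialUnitaryGroup cmp'_specialUnitaryGroup)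

variable {n : Type*} [Fintype n] [DecidableEq n] [Nonempty n]

/-- From an energy bound to a size bound on `SU(N)`: `1 − reTr g ≤ e ⇒ |g − 1| ≤ √(2N·e)` (tree `cmp'_specialUnitaryGroup`).
[cite: Balaban1985RegularSpaces, (1.10) p.77] -/
theorem dist1_le_sqrt_of_one_sub_reTr_le (g : Matrix.specialUnitaryGroup n ℂ) {e : ℝ} (he : 1 - reTr g ≤ e) :
    dist1 g ≤ Real.sqrt (2 * (Fintype.card n : ℝ) * e) := by
  have h1 : dist1 g ^ 2 ≤ 2 * (Fintype.card n : ℝ) * e :=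
    (cmp'_specialUnitaryGroup g).trans (mul_le_mul_of_nonneg_left he (by positivity))
  have h2 := Real.abs_le_sqrt h1
  rwa [abs_of_nonneg (GaugeGroup.dist1_nonneg g)] at h2

/-- **THE DOMINATION LETTER FOR THE (0.4) AVERAGING OF RECORD** (standing range `j + 1 ≤ m + K`; `SU(N)`, `N = |n|`): let `R` be any finite set of
plaquettes of `T^{(j)}` containing every plaquette cornered at a site `walkEnd (emb p′₋) v`, `|v| ≤ (d+3)L + 2`, and let `α` satisfy
`(((d+2)L)²/4)·√(2Nα) < δ_N`.  If `1 − reTr U(∂q) ≤ α` for every `q ∈ R`, then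
`1 − reTr Ū(∂p′) ≤ 2N·(L² + 6((d+2)L)²)²·Σ_{q∈R} (1 − reTr U(∂q))`, `Ū = avgFun expMeanLogSU U`.  (Every `q ∈ R` has `|U(∂q) − 1| ≤ δ :=
min(√(2Nα), √(2N·Σ))` by `cmp'`; §2 gives `|Ū(∂p′) − 1| ≤ C_L·δ`; `cmp` and `δ² ≤ 2N·Σ` conclude — the «max ≤ sum» step.)
[cite: Balaban1985Averaging, Prop. 1 (51) p.26; Balaban1987RG1, (0.4) p.253; Balaban1985RegularSpaces, (1.10) p.77] -/
theorem one_sub_reTr_plaqHol_avgFun_le_mul_sum (hj : j + 1 ≤ P.m + P.K) {α : ℝ}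
    (hguard : ((((P.d + 2) * P.L : ℕ) : ℝ) ^ 2 / 4) * Real.sqrt (2 * (Fintype.card n : ℝ) * α) < deltaSU n)
    {U : GaugeField P j (Matrix.specialUnitaryGroup n ℂ)} (p : Plaq P (j + 1)) (R : Finset (Plaq P j))
    (hR : ∀ v : List (Letter P.d), v.length ≤ (P.d + 3) * P.L + 2 →
      ∀ (a b : Fin P.d) (h : a < b), (⟨walkEnd (emb p.src) v, a, b, h⟩ : Plaq P j) ∈ R)
    (hsmall : ∀ q ∈ R, 1 - reTr (GaugeField.plaqHol U q) ≤ α) :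
    1 - reTr (GaugeField.plaqHol (avgFun (expMeanLogSU (n := n)) U) p) ≤
      2 * (Fintype.card n : ℝ) * ((P.L : ℝ) ^ 2 + 6 * (((P.d + 2) * P.L : ℕ) : ℝ) ^ 2) ^ 2 *
        ∑ q ∈ R, (1 - reTr (GaugeField.plaqHol U q)) := by
  set N : ℝ := (Fintype.card n : ℝ) with hN
  set S : ℝ := ∑ q ∈ R, (1 - reTr (GaugeField.plaqHol U q)) with hS
  set C : ℝ := (P.L : ℝ) ^ 2 + 6 * (((P.d + 2) * P.L : ℕ) : ℝ) ^ 2 with hC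
  have hS0 : 0 ≤ S := Finset.sum_nonneg fun q _ => sub_nonneg.mpr (GaugeGroup.reTr_le_one _)
  have hN0 : 0 ≤ N := Nat.cast_nonneg _
  -- the common size bound near `p′`
  set δ : ℝ := min (Real.sqrt (2 * N * α)) (Real.sqrt (2 * N * S)) with hδdef
  have hδ0 : 0 ≤ δ := le_min (Real.sqrt_nonneg _) (Real.sqrt_nonneg _)
  have hU : ∀ v : List (Letter P.d), v.length ≤ (P.d + 3) * P.L + 2 →
      ∀ (a b : Fin P.d) (h : a < b), dist1 (GaugeField.plaqHol U ⟨walkEnd (emb p.src) v, a, b, h⟩) ≤ δ := by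
    intro v hv a b h
    have hq := hR v hv a b h
    have he := hsmall _ hq
    have heS : 1 - reTr (GaugeField.plaqHol U ⟨walkEnd (emb p.src) v, a, b, h⟩) ≤ S :=
      Finset.single_le_sum (f := fun q => 1 - reTr (GaugeField.plaqHol U q)) (fun q _ => sub_nonneg.mpr (GaugeGroup.reTr_le_one _)) hq
    exact le_min (dist1_le_sqrt_of_one_sub_reTr_le _ he) (dist1_le_sqrt_of_one_sub_reTr_le _ heS)
  have hκ0 : 0 ≤ (((P.d + 2) * P.L : ℕ) : ℝ) ^ 2 / 4 := by positivity
  have ht : ((((P.d + 2) * P.L : ℕ) : ℝ) ^ 2 / 4) * δ < deltaSU n :=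
    (mul_le_mul_of_nonneg_left (min_le_left _ _) hκ0).trans_lt hguard
  have hdist : dist1 (GaugeField.plaqHol (avgFun (expMeanLogSU (n := n)) U) p) ≤ C * δ :=
    dist1_plaqHol_avgFun_le_loc (n := n) hj hδ0 p hU ht
  have hC0 : 0 ≤ C := by positivity
  have hδsq : δ ^ 2 ≤ 2 * N * S := by
    have h1 : δ ≤ Real.sqrt (2 * N * S) := min_le_right _ _
    calc δ ^ 2 ≤ Real.sqrt (2 * N * S) ^ 2 := pow_le_pow_left₀ hδ0 h1 2
      _ = 2 * N * S := Real.sq_sqrt (by positivity)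
  calc 1 - reTr (GaugeField.plaqHol (avgFun (expMeanLogSU (n := n)) U) p)
      ≤ dist1 (GaugeField.plaqHol (avgFun (expMeanLogSU (n := n)) U) p) ^ 2 := cmp_specialUnitaryGroup _
    _ ≤ (C * δ) ^ 2 := pow_le_pow_left₀ (GaugeGroup.dist1_nonneg _) hdist 2
    _ = C ^ 2 * δ ^ 2 := by ring
    _ ≤ C ^ 2 * (2 * N * S) := mul_le_mul_of_nonneg_left hδsq (sq_nonneg _)
    _ = 2 * N * C ^ 2 * S := by ring

/-- **THE SAME WITH A GEOMETRIC REGION**: it suffices that `R` contain every plaquette cornered at a site of the `ℓ∞`-ball of radius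
`(d+3)L + 2` around `emb p′₋` (coordinates `(emb p′₋) ν + e`, `|e| ≤ (d+3)L + 2`) — the walk ends lie in that ball
(`HistoryTailWalkLocality.walkEnd_mem_box`).  This is the hypothesis shape `hdom` of `N20LCSPushforward.localExpMoment_blockMap` for the block
map `avgFun expMeanLogSU`, with `C₁ = 2N·(L² + 6((d+2)L)²)²` and a box region of bounded size and multiplicity.
[cite: Balaban1985Averaging, Prop. 1 (51) p.26; Balaban1987RG1, (0.4) p.253] -/
theorem one_sub_reTr_plaqHol_avgFun_le_mul_sum_of_box (hj : j + 1 ≤ P.m + P.K) {α : ℝ}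
    (hguard : ((((P.d + 2) * P.L : ℕ) : ℝ) ^ 2 / 4) * Real.sqrt (2 * (Fintype.card n : ℝ) * α) < deltaSU n)
    {U : GaugeField P j (Matrix.specialUnitaryGroup n ℂ)} (p : Plaq P (j + 1)) (R : Finset (Plaq P j))
    (hR : ∀ z : Site P j, (∀ ν, ∃ e : ℤ, |e| ≤ (((P.d + 3) * P.L + 2 : ℕ) : ℤ) ∧ z ν = (emb p.src) ν + (e : ZMod (P.sitesPerDir j))) →
      ∀ (a b : Fin P.d) (h : a < b), (⟨z, a, b, h⟩ : Plaq P j) ∈ R)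
    (hsmall : ∀ q ∈ R, 1 - reTr (GaugeField.plaqHol U q) ≤ α) :
    1 - reTr (GaugeField.plaqHol (avgFun (expMeanLogSU (n := n)) U) p) ≤
      2 * (Fintype.card n : ℝ) * ((P.L : ℝ) ^ 2 + 6 * (((P.d + 2) * P.L : ℕ) : ℝ) ^ 2) ^ 2 *
        ∑ q ∈ R, (1 - reTr (GaugeField.plaqHol U q)) := by
  refine one_sub_reTr_plaqHol_avgFun_le_mul_sum (n := n) hj hguard p R (fun v hv a b h => ?_) hsmall
  refine hR (walkEnd (emb p.src) v) (fun ν => ?_) a b h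
  obtain ⟨e, he, hw⟩ := walkEnd_mem_box (emb p.src) v ν
  exact ⟨e, he.trans (by exact_mod_cast hv), hw⟩

end Energy

end Summit.QuantumFields.YangMills.BalabanUVNodes.N20LCSAvgDomination

end
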